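import Summits.AtomisticToContinuum.Crystallization.Theorems.ChargedEnergyGapPhiConvex
import HarnessLib

/-!
# ChargedEnergyGap · NODE 120-P «PhiLogConcave» — the depth profile `φ = depthProfile 160` is LOG-CONCAVE on `[120, 160]`:
# the two-point RATIO LAW `φ(x+a)·φ(y) ≤ φ(y+a)·φ(x)` (`120 ≤ y ≤ x`, `0 ≤ a`, `x + a ≤ 160`)

decomp-a2c lens-5 g120 (support P of NODE 120 «ZeroZoneSplit»: the one analytic input of the homogeneity lever — in RATIO coordinates
`w = W/φ(C−ρ)` every pairwise weight bound of an admissible tuple is pinned by a two-point evaluation of `φ` at an END of the C-band).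
Imports tree …ChargedEnergyGapPhiConvex (NODE 97: `sPoly`, `phiPoly`, `hasDerivAt_sPoly_u`, `hasDerivAt_uAff`, `depthProfile_eq_phiPoly`,
`sPoly_mem`, `sPoly_mono`) + HarnessLib.

§120P.1 `qProf d = 1 − sPoly (2 − 2d/160)` (the fourth root of `phiPoly`; `phiPoly = qProf⁴` by `rfl`), `1/2 ≤ qProf ≤ 1` on `[120,160]`.
§120P.2 Derivatives (HasDerivAt calculus + `ring`, as NODE 97): `qProf′ = qD1 = (7/4)u³(1−u)³`, `qD1′ = qD2 = −(21/320)u²(1−u)²(1−2u)`, `u = 2 − 2d/160`.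
§120P.3 Sign: `qD2 ≤ 0` for `120 ≤ d ≤ 160` (`u ∈ [0, 1/2]`, so `1 − 2u ≥ 0`); ★★ `qProf_concaveOn : ConcaveOn ℝ (Set.Icc 120 160) qProf`
  (Mathlib `concaveOn_of_hasDerivWithinAt2_nonpos`).  (NODE 97 proved `φ` itself CONVEX on `[80,134]`; here its fourth root is CONCAVE on `[120,160]` —
  the two facts together say `φ` is log-concave yet convex on the zero zone, i.e. `0 ≤ φ″φ ≤ φ′²·(3/4)·…`.)
§120P.4 ★★ `ratio_le_of_concaveOn`: for ANY non-negative concave `f` on an interval, `f(x+a)·f(y) ≤ f(y+a)·f(x)` (`y ≤ x`, `0 ≤ a`) — three-line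
  convexity at the two inner points + AM-GM; no logarithms, no derivatives.
§120P.5 ★★★ `depthProfile_ratio_le` (THE PROFILE RATIO LAW) = `(qProf ratio law)⁴`; the two oriented forms `depthProfile_ratio_upper/lower`
  (bound a ratio over a band by its value at the band's LOW / HIGH end) and one kernel-checked numeric band-end row (`ratioRow_R1`: the box-ratio
  constant `1.1863` of NODE 120's `RegionHi`).

[SUPPORT node: all PROVED, 0 sorry; 3 defs (`qProf`, `qD1`, `qD2`), theorems only otherwise; no `instance`/`notation`/`set_option`.]
-/

noncomputable section
open scoped Classical
open Literature.MathematicalPhysics.StatisticalMechanics Literature.Geometry.DiscreteGeometry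
open Summit.AtomisticToContinuum.Crystallization.Theses.PricedLinkCensus
open Summit.AtomisticToContinuum.Crystallization.Theorems.ChargedEnergyGapNegative

namespace Summit.AtomisticToContinuum.Crystallization.Theorems.ChargedEnergyGapChartDial

/-! ## §120P.1 The fourth-root profile -/

/-- ★ `qProf d = 1 − S(2 − 2d/160)`: the fourth root of the polynomial form of `φ`. -/
def qProf (d : ℝ) : ℝ := 1 - sPoly (2 - 2 * d / 160)

/-- [formal bookkeeping] `phiPoly = qProf⁴`. -/
theorem phiPoly_eq_qProf_pow (d : ℝ) : phiPoly d = qProf d ^ 4 := rfl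

/-- [formal bookkeeping] `φ = qProf⁴` on `[80, 160]`. -/
theorem depthProfile_eq_qProf_pow {d : ℝ} (h0 : 80 ≤ d) (h1 : d ≤ 160) : depthProfile 160 d = qProf d ^ 4 := by
  rw [depthProfile_eq_phiPoly h0 h1, phiPoly_eq_qProf_pow]

/-- ★ `1/2 ≤ qProf d ≤ 1` on `[120, 160]` (`S` is monotone with `S(1/2) = 1/2`, and `S ≥ 0`). -/
theorem qProf_mem {d : ℝ} (h0 : 120 ≤ d) (h1 : d ≤ 160) : 1 / 2 ≤ qProf d ∧ qProf d ≤ 1 := by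
  have hu0 : 0 ≤ 2 - 2 * d / 160 := by linarith
  have hu1 : 2 - 2 * d / 160 ≤ 1 / 2 := by linarith
  have hS : sPoly (2 - 2 * d / 160) ≤ sPoly (1 / 2) := sPoly_mono hu0 hu1 (by norm_num)
  have hhalf : sPoly (1 / 2 : ℝ) = 1 / 2 := by norm_num [sPoly]
  obtain ⟨hS0, _⟩ := sPoly_mem hu0 (by linarith)
  unfold qProf
  constructor <;> linarith

/-- `0 < qProf d` on `[120, 160]`. -/
theorem qProf_pos {d : ℝ} (h0 : 120 ≤ d) (h1 : d ≤ 160) : 0 < qProf d := by linarith [(qProf_mem h0 h1).1]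

/-! ## §120P.2 Derivatives -/

/-- ★ First derivative of `qProf` (factored): `(7/4)·u³(1−u)³`, `u = 2 − 2d/160`. -/
def qD1 (d : ℝ) : ℝ := 7 / 4 * ((2 - 2 * d / 160) ^ 3 * (1 - (2 - 2 * d / 160)) ^ 3)

/-- ★ Second derivative of `qProf` (factored): `−(21/320)·u²(1−u)²(1−2u)`, `u = 2 − 2d/160`. -/
def qD2 (d : ℝ) : ℝ := -(21 / 320) * ((2 - 2 * d / 160) ^ 2 * (1 - (2 - 2 * d / 160)) ^ 2 * (1 - 2 * (2 - 2 * d / 160)))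

/-- ★★ `qProf′ = qD1`. -/
theorem hasDerivAt_qProf (d : ℝ) : HasDerivAt qProf (qD1 d) d := by
  have h := (hasDerivAt_const d (1 : ℝ)).fun_sub (hasDerivAt_sPoly_u d)
  unfold qProf
  refine h.congr_deriv ?_
  simp only [qD1]
  ring

/-- ★★ `qD1′ = qD2`. -/
theorem hasDerivAt_qD1 (d : ℝ) : HasDerivAt qD1 (qD2 d) d := by
  have hB := (hasDerivAt_uAff d).fun_pow 3
  have hC := ((hasDerivAt_const d (1 : ℝ)).fun_sub (hasDerivAt_uAff d)).fun_pow 3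
  have h := (hB.fun_mul hC).const_mul (7 / 4 : ℝ)
  unfold qD1
  refine h.congr_deriv ?_
  simp only [qD2]
  norm_num
  ring

/-! ## §120P.3 Sign of the second derivative and concavity on `[120, 160]` -/

/-- ★★ `qD2 d ≤ 0` for `120 ≤ d ≤ 160`. -/
theorem qD2_nonpos {d : ℝ} (h0 : 120 ≤ d) (_h1 : d ≤ 160) : qD2 d ≤ 0 := by
  have hu1 : 2 - 2 * d / 160 ≤ 1 / 2 := by linarith
  have hlin : 0 ≤ 1 - 2 * (2 - 2 * d / 160) := by linarith
  have hsq : 0 ≤ (2 - 2 * d / 160) ^ 2 * (1 - (2 - 2 * d / 160)) ^ 2 * (1 - 2 * (2 - 2 * d / 160)) :=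
    mul_nonneg (by positivity) hlin
  unfold qD2
  rw [neg_mul]
  exact neg_nonpos.mpr (mul_nonneg (by norm_num) hsq)

/-- ★★★ `qProf` is CONCAVE on `[120, 160]`. -/
theorem qProf_concaveOn : ConcaveOn ℝ (Set.Icc 120 160) qProf := by
  have hcont : Continuous qProf := by unfold qProf sPoly; fun_prop
  refine concaveOn_of_hasDerivWithinAt2_nonpos (convex_Icc 120 160) hcont.continuousOn
    (fun x _ => (hasDerivAt_qProf x).hasDerivWithinAt) (fun x _ => (hasDerivAt_qD1 x).hasDerivWithinAt) ?_
  intro x hx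
  rw [interior_Icc] at hx
  exact qD2_nonpos hx.1.le hx.2.le

/-! ## §120P.4 The ratio law of a non-negative concave function (generic) -/

/-- ★★ TWO-POINT RATIO LAW: for `f` concave and non-negative on `[lo, hi]`, `lo ≤ y ≤ x`, `0 ≤ a`, `x + a ≤ hi`:
`f (x + a) · f y ≤ f (y + a) · f x` — ratios `f(·+a)/f(·)` decrease (log-concavity without logarithms).
PROOF: `x` and `y + a` are the convex combinations `t·y + s·(x+a)`, `s·y + t·(x+a)` with `s = (x−y)/(x−y+a)`, `t = a/(x−y+a)`;
concavity bounds `f x`, `f (y+a)` below by the mixed means, whose product exceeds `f y · f (x+a)` by `st (f y − f (x+a))²`. -/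
theorem ratio_le_of_concaveOn {lo hi : ℝ} {f : ℝ → ℝ} (hf : ConcaveOn ℝ (Set.Icc lo hi) f)
    (hpos : ∀ z, lo ≤ z → z ≤ hi → 0 ≤ f z) {x y a : ℝ} (hy : lo ≤ y) (hyx : y ≤ x) (ha : 0 ≤ a) (hxa : x + a ≤ hi) :
    f (x + a) * f y ≤ f (y + a) * f x := by
  rcases eq_or_lt_of_le (show 0 ≤ x - y + a by linarith) with hD | hD
  · have hx : x = y := by linarith
    have ha0 : a = 0 := by linarith
    subst hx
    rw [ha0, add_zero]
  · have hyS : y ∈ Set.Icc lo hi := ⟨hy, by linarith⟩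
    have hxaS : x + a ∈ Set.Icc lo hi := ⟨by linarith, hxa⟩
    set s := (x - y) / (x - y + a) with hs
    set t := a / (x - y + a) with ht
    have hs0 : 0 ≤ s := div_nonneg (by linarith) hD.le
    have ht0 : 0 ≤ t := div_nonneg ha hD.le
    have hst : s + t = 1 := by
      rw [hs, ht, ← add_div]
      exact div_self (ne_of_gt hD) ▸ by ring_nf
    have hts : t + s = 1 := by linarith
    have e1 : t • y + s • (x + a) = x := by
      simp only [smul_eq_mul]; rw [hs, ht]; field_simp; ring
    have e2 : s • y + t • (x + a) = y + a := by
      simp only [smul_eq_mul]; rw [hs, ht]; field_simp; ring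
    have k1 := hf.2 hyS hxaS ht0 hs0 hts
    have k2 := hf.2 hyS hxaS hs0 ht0 hst
    rw [e1] at k1
    rw [e2] at k2
    simp only [smul_eq_mul] at k1 k2
    have hfy : 0 ≤ f y := hpos y hy (by linarith)
    have hF : 0 ≤ f (x + a) := hpos (x + a) (by linarith) hxa
    have hL0 : 0 ≤ t * f y + s * f (x + a) := by positivity
    have hM0 : 0 ≤ s * f y + t * f (x + a) := by positivity
    have prod : (t * f y + s * f (x + a)) * (s * f y + t * f (x + a)) ≤ f x * f (y + a) :=
      mul_le_mul k1 k2 hM0 (le_trans hL0 k1)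
    have ht' : t = 1 - s := by linarith
    rw [ht'] at prod
    have hs1 : s ≤ 1 := by linarith
    nlinarith [prod, mul_nonneg (mul_nonneg hs0 (sub_nonneg.2 hs1)) (sq_nonneg (f y - f (x + a)))]

/-! ## §120P.5 ★★★ The profile ratio law -/

/-- ★★ Ratio law for `qProf` on `[120, 160]`. -/
theorem qProf_ratio_le {x y a : ℝ} (hy : 120 ≤ y) (hyx : y ≤ x) (ha : 0 ≤ a) (hxa : x + a ≤ 160) :
    qProf (x + a) * qProf y ≤ qProf (y + a) * qProf x :=
  ratio_le_of_concaveOn qProf_concaveOn (fun _ h0 h1 => (qProf_pos h0 h1).le) hy hyx ha hxa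

/-- ★★★ **THE PROFILE RATIO LAW** (log-concavity of `φ = depthProfile 160` on `[120, 160]`, two-point form):
for `120 ≤ y ≤ x`, `0 ≤ a`, `x + a ≤ 160`:  `φ(x + a)·φ(y) ≤ φ(y + a)·φ(x)`. -/
theorem depthProfile_ratio_le {x y a : ℝ} (hy : 120 ≤ y) (hyx : y ≤ x) (ha : 0 ≤ a) (hxa : x + a ≤ 160) :
    depthProfile 160 (x + a) * depthProfile 160 y ≤ depthProfile 160 (y + a) * depthProfile 160 x := by
  rw [depthProfile_eq_qProf_pow (d := x + a) (by linarith) hxa, depthProfile_eq_qProf_pow (d := y) (by linarith) (by linarith),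
    depthProfile_eq_qProf_pow (d := y + a) (by linarith) (by linarith), depthProfile_eq_qProf_pow (d := x) (by linarith) (by linarith),
    ← mul_pow, ← mul_pow]
  have h0 : 0 ≤ qProf (x + a) * qProf y := mul_nonneg (qProf_pos (by linarith) hxa).le (qProf_pos hy (by linarith)).le
  exact pow_le_pow_left₀ h0 (qProf_ratio_le hy hyx ha hxa) 4

/-- ★★ UPPER RATIO ROW (band evaluated at its LOW end `x₀`): `x₀ ≤ x`, `0 ≤ h` ⇒ `φ(x + h)·φ(x₀) ≤ φ(x₀ + h)·φ(x)`,
i.e. `φ(x + h) ≤ [φ(x₀ + h)/φ(x₀)]·φ(x)`. -/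
theorem depthProfile_ratio_upper {x₀ x h : ℝ} (h0 : 120 ≤ x₀) (hx : x₀ ≤ x) (hh : 0 ≤ h) (hxh : x + h ≤ 160) :
    depthProfile 160 (x + h) * depthProfile 160 x₀ ≤ depthProfile 160 (x₀ + h) * depthProfile 160 x :=
  depthProfile_ratio_le h0 hx hh hxh

/-- ★★ LOWER RATIO ROW (band evaluated at its HIGH end `x₁`): `x ≤ x₁`, `0 ≤ h` ⇒ `φ(x₁ + h)·φ(x) ≤ φ(x + h)·φ(x₁)`,
i.e. `φ(x + h) ≥ [φ(x₁ + h)/φ(x₁)]·φ(x)`. -/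
theorem depthProfile_ratio_lower {x x₁ h : ℝ} (h0 : 120 ≤ x) (hx : x ≤ x₁) (hh : 0 ≤ h) (hxh : x₁ + h ≤ 160) :
    depthProfile 160 (x₁ + h) * depthProfile 160 x ≤ depthProfile 160 (x + h) * depthProfile 160 x₁ :=
  depthProfile_ratio_le h0 hx hh hxh

/-- ★ The band-end evaluation behind the box-ratio constant `R1 = 1.1863` of NODE 120 `RegionHi` (kernel-checked rational arithmetic on `qProf⁴`):
`φ(128809/1000 + 1382/1000)·10000 ≤ 11863·φ(128809/1000)`. -/
theorem ratioRow_R1_end : depthProfile 160 (128809 / 1000 + 1382 / 1000) * 10000 ≤ 11863 * depthProfile 160 (128809 / 1000) := by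
  rw [depthProfile_eq_qProf_pow (by norm_num) (by norm_num), depthProfile_eq_qProf_pow (by norm_num) (by norm_num)]
  norm_num [qProf, sPoly]

/-- ★★ THE BOX-RATIO ROW of NODE 120 (`R1`): on the high part (`x = C − ρ ≥ 128809/1000`, `2ρ ≤ 1382/1000`), every vertex weight is at most
`1.1863·φ(C − ρ)`: for `128809/1000 ≤ x`, `0 ≤ h ≤ 1382/1000`, `x + 1382/1000 ≤ 160`: `φ(x + h)·10000 ≤ 11863·φ(x)`. -/
theorem ratioRow_R1 {x h : ℝ} (hx : 128809 / 1000 ≤ x) (hh : h ≤ 1382 / 1000) (hxh : x + 1382 / 1000 ≤ 160) :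
    depthProfile 160 (x + h) * 10000 ≤ 11863 * depthProfile 160 x := by
  have hmono : depthProfile 160 (x + h) ≤ depthProfile 160 (x + 1382 / 1000) := depthProfile_monotone (by norm_num) (by linarith)
  have hrat := depthProfile_ratio_upper (x₀ := 128809 / 1000) (x := x) (h := 1382 / 1000) (by norm_num) hx (by norm_num) hxh
  have hend := ratioRow_R1_end
  have hφ0 : 0 < depthProfile 160 (128809 / 1000 : ℝ) := by
    rw [depthProfile_eq_qProf_pow (by norm_num) (by norm_num)]; exact pow_pos (qProf_pos (by norm_num) (by norm_num)) 4
  have hφx : 0 ≤ depthProfile 160 x := by unfold depthProfile; positivity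
  nlinarith [mul_le_mul_of_nonneg_right hrat (show (0:ℝ) ≤ 10000 by norm_num), mul_le_mul_of_nonneg_right hend hφx]

end Summit.AtomisticToContinuum.Crystallization.Theorems.ChargedEnergyGapChartDial

end
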